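import Literature.Barriers.CriticalPhenomena.EmbeddingModulusUniquenessProofs
import Literature.Probability.Percolation.CardyCarleson
import Summits.CriticalPhenomena.CardyFormulaZ2.Theses.CardyIKTransport

/-!
# `SimilarityRigidity` (route `CardyIKTransport`, item stmt-CriticalPhenomena-4970) — proved

**Statement** (`Summit.CriticalPhenomena.CardyFormulaZ2.Theses.CardyIKTransport.SimilarityRigidity`).
A real-linear automorphism `E : ℂ ≃L[ℝ] ℂ` of the plane which preserves the conformal modulus of
every conformal rectangle — every uniformizing datum `(φ, x)` of `R` and every uniformizing datum
`(φ', x')` of the image rectangle `R.map E` have equal cross-ratios — is a similarity in the norm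
sense: `‖E z‖ = c ‖z‖` for some `c > 0`.

**Proof** (Beffara 2008, proof of Prop. 4, arXiv:0708.3908 p. 6, through the tree's
`Literature.Barriers.CriticalPhenomena.BeffaraShearDistortsModulus_holds`).
* `apply_eq_mul_moduliShear`: with `a = E 1 ≠ 0` and `β = a⁻¹ E i`, real-linearity gives
  `E z = a · φ_β(z)` where `φ_β(x + iy) = x + β y` is Beffara's shear (`moduliShear β`); `β ∉ ℝ`
  because `E` is injective (`im_ne_zero_of_apply_eq_mul_moduliShear`).
* If `β = i` then `E z = a z`; if `β = -i` then `E z = a z̄`; in both cases `‖E z‖ = ‖a‖ ‖z‖`.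
* If `im β > 0`, `β ≠ i`: `BeffaraShearDistortsModulus_holds β` supplies rectangles `R₁, R₂` with
  uniformizing data of equal cross-ratio whose `φ_β`-images `R₁', R₂'` have uniformizing data
  `(φⱼ', xⱼ')` of different cross-ratios. The rectangle `Rⱼ.map E` is the image of `Rⱼ'` under the
  similarity `z ↦ a z` (same carrier and marked points), so `(a · φⱼ', xⱼ')` uniformizes it
  (`exists_isUniformizing_of_eq_image_mul`: compose with `similarityConformalEquiv` and the
  identity `ConformalEquiv.ofEq` across the equality of carriers; boundary values compose,
  `hasBoundaryValue_trans`). The hypothesis then gives `η(x₁') = η(x₁) = η(x₂) = η(x₂')`,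
  a contradiction.
* If `im β < 0`, `β ≠ -i`: `γ = β̄ ∈ ℍ ∖ {i}` and `φ_β = conj ∘ φ_γ`; run the same argument with
  `BeffaraShearDistortsModulus_holds γ`, inserting the conjugate rectangle `Rⱼ'*`
  (`MarkedDomain.conjugate`), uniformized by `(φⱼ'*, -xⱼ')`
  (`MarkedDomain.IsUniformizing.exists_conjugate`) with the same cross-ratio (`crossRatio_neg`);
  `Rⱼ.map E` is the image of `Rⱼ'*` under `z ↦ a z`.
-/

noncomputable section

namespace Summit.CriticalPhenomena.CardyFormulaZ2.Theorems

open Set Filter Topology Complex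
open UpperHalfPlane (upperHalfPlaneSet)
open scoped ComplexConjugate
open Literature.Probability.RandomPlanarGeometry
open Literature.Probability.LatticeModels (conjSet conjSet_eq_image)
open Literature.Barriers.CriticalPhenomena

namespace CardyIKTransportSimilarityRigidity

/-- **Transport of uniformizing data along a similarity `z ↦ a z`.** If the marked domain `D'`
is the image of `D` under `z ↦ a z` (`a ≠ 0`) — same carrier image and marked points — then every
uniformizing datum `(φ, x)` of `D` yields a uniformizing datum `(a · φ, x)` of `D'` with the SAME
boundary preimages `x` (compose `φ` with the similarity as a conformal equivalence onto its image,
`ChordalFamily.similarityConformalEquiv`, and with the identity across the equality of carriers,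
`ConformalEquiv.ofEq`; boundary values compose, `ConformalEquiv.hasBoundaryValue_trans`). -/
theorem exists_isUniformizing_of_eq_image_mul {n : ℕ} {D D' : MarkedDomain n} {a : ℂ} (ha : a ≠ 0)
    (hc : D'.carrier = (fun z ↦ a * z) '' D.carrier) (hp : ∀ i, D'.pt i = a * D.pt i)
    {φ : ConformalEquiv upperHalfPlaneSet D.carrier} {x : Fin n → ℝ} (h : D.IsUniformizing φ x) :
    ∃ ψ : ConformalEquiv upperHalfPlaneSet D'.carrier, D'.IsUniformizing ψ x := by
  have hc' : similarity a ha 0 '' D.carrier = D'.carrier := by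
    rw [hc]
    exact image_congr' fun z ↦ by rw [similarity_apply, add_zero]
  refine ⟨(φ.trans (ChordalFamily.similarityConformalEquiv a ha 0 D.carrier)).trans
    (ConformalEquiv.ofEq hc'), h.1, fun i ↦ ?_⟩
  have h1 := ConformalEquiv.hasBoundaryValue_trans _ _ (h.2 i)
    (ChordalFamily.hasBoundaryValue_similarityConformalEquiv a ha 0 D.carrier (D.pt i))
  have h2 := ConformalEquiv.hasBoundaryValue_trans _ _ h1
    (ConformalEquiv.hasBoundaryValue_ofEq hc' (a * D.pt i + 0))
  rw [hp i, ← add_zero (a * D.pt i)]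
  exact h2

/-- **A real-linear automorphism of `ℂ` is a scaled Beffara shear**: `E z = E 1 · φ_β(z)` with
`β = (E 1)⁻¹ E i`, where `φ_β(x + iy) = x + β y` (`moduliShear β`). (Real-linearity:
`E (x + iy) = x E 1 + y E i`.) -/
theorem apply_eq_mul_moduliShear (E : ℂ ≃L[ℝ] ℂ) (hE1 : E 1 ≠ 0) (z : ℂ) :
    E z = E 1 * moduliShear ((E 1)⁻¹ * E I) z := by
  have hz : ((z.re : ℝ) • (1 : ℂ)) + ((z.im : ℝ) • I) = z := by
    rw [Complex.real_smul, Complex.real_smul, mul_one, Complex.re_add_im]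
  conv_lhs => rw [← hz]
  rw [map_add, E.map_smul, E.map_smul, Complex.real_smul, Complex.real_smul, moduliShear]
  have h2 : E 1 * ((E 1)⁻¹ * E I) = E I := by rw [← mul_assoc, mul_inv_cancel₀ hE1, one_mul]
  linear_combination (-(z.im : ℂ)) * h2

/-- `E 1 ≠ 0` for a real-linear automorphism `E` of `ℂ` (injectivity). -/
theorem apply_one_ne_zero (E : ℂ ≃L[ℝ] ℂ) : E 1 ≠ 0 := by
  intro h0
  have h : E 1 = E 0 := by rw [h0, map_zero]
  exact one_ne_zero (E.injective h)

/-- The shear parameter `β = (E 1)⁻¹ E i` of a real-linear automorphism `E` of `ℂ` is not real: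
otherwise `E i = E 1 · β = E β`, contradicting injectivity. -/
theorem im_shearParam_ne_zero (E : ℂ ≃L[ℝ] ℂ) : ((E 1)⁻¹ * E I).im ≠ 0 := by
  intro h0
  have hE1 := apply_one_ne_zero E
  set β : ℂ := (E 1)⁻¹ * E I with hβ
  have hβreal : ((β.re : ℝ) : ℂ) = β := Complex.ext (by simp) (by simp [h0])
  have h1 : E (β.re : ℂ) = E 1 * β := by
    rw [apply_eq_mul_moduliShear E hE1, moduliShear, Complex.ofReal_re, Complex.ofReal_im,
      Complex.ofReal_zero, mul_zero, add_zero, hβreal]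
  have h2 : E I = E 1 * β := by rw [hβ, ← mul_assoc, mul_inv_cancel₀ hE1, one_mul]
  have h3 : (I : ℂ) = (β.re : ℂ) := E.injective (h2.trans h1.symm)
  have h4 := congrArg Complex.im h3
  simp at h4

end CardyIKTransportSimilarityRigidity

open CardyIKTransportSimilarityRigidity

/-- **`SimilarityRigidity` — PROVED** (item stmt-CriticalPhenomena-4970 of route
`CardyIKTransport`): a real-linear automorphism of `ℂ` preserving the conformal modulus of every
conformal rectangle is a similarity, `‖E z‖ = c ‖z‖` with `c > 0`. Beffara 2008 (arXiv:0708.3908),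
proof of Prop. 4, via `BeffaraShearDistortsModulus_holds`; see the module docstring. -/
theorem similarityRigidity_proof :
    Summit.CriticalPhenomena.CardyFormulaZ2.Theses.CardyIKTransport.SimilarityRigidity := by
  unfold Summit.CriticalPhenomena.CardyFormulaZ2.Theses.CardyIKTransport.SimilarityRigidity
  intro E hE
  have ha : E 1 ≠ 0 := apply_one_ne_zero E
  set a : ℂ := E 1 with ha_def
  set β : ℂ := a⁻¹ * E I with hβ_def
  have hEz : ∀ z, E z = a * moduliShear β z := fun z ↦ apply_eq_mul_moduliShear E ha z
  have hβim : β.im ≠ 0 := im_shearParam_ne_zero E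
  -- it suffices that `β = ± i`
  suffices hβ : β = I ∨ β = -I by
    refine ⟨‖a‖, norm_pos_iff.2 ha, fun z ↦ ?_⟩
    rcases hβ with h | h
    · rw [hEz, h, moduliShear_I_apply, norm_mul]
    · rw [hEz, h, moduliShear_neg_I_apply, norm_mul, Complex.norm_conj]
  by_contra hne
  push Not at hne
  -- the image rectangle `R.map E` as a function image
  have hmapc : ∀ R : ConformalRectangle, (R.map E.toHomeomorph).carrier = E '' R.carrier :=
    fun R ↦ by rw [MarkedDomain.carrier_map, ContinuousLinearEquiv.coe_toHomeomorph]
  have hmapp : ∀ (R : ConformalRectangle) (i : Fin 4), (R.map E.toHomeomorph).pt i = E (R.pt i) :=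
    fun R i ↦ by rw [MarkedDomain.pt_map, ContinuousLinearEquiv.coe_toHomeomorph]
  rcases lt_or_gt_of_ne hβim with hlt | hgt
  · -- `im β < 0`: work with `γ = conj β ∈ ℍ ∖ {i}` and the conjugate rectangles
    set γ : ℂ := conj β with hγ
    have hγim : 0 < γ.im := by rw [hγ, Complex.conj_im]; linarith
    have hγI : γ ≠ I := by
      intro h
      apply hne.2
      rw [← Complex.conj_conj β, ← hγ, h, Complex.conj_I]
    have hshear : ∀ z, moduliShear β z = conj (moduliShear γ z) := by
      intro z
      rw [moduliShear, moduliShear, map_add, map_mul, Complex.conj_ofReal, Complex.conj_ofReal, hγ,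
        Complex.conj_conj]
    obtain ⟨R₁, R₂, R₁', R₂', φ₁, x₁, φ₂, x₂, φ₁', x₁', φ₂', x₂', h₁, h₂, h₁', h₂', ⟨hc₁, hp₁⟩,
      ⟨hc₂, hp₂⟩, hcr, hcr'⟩ := BeffaraShearDistortsModulus_holds γ hγim hγI
    have key : ∀ (R R' : ConformalRectangle) (φ' : ConformalEquiv upperHalfPlaneSet R'.carrier)
        (x' : Fin 4 → ℝ), R'.IsUniformizing φ' x' → R'.carrier = moduliShear γ '' R.carrier →
        (∀ i, R'.pt i = moduliShear γ (R.pt i)) →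
        ∃ ψ : ConformalEquiv upperHalfPlaneSet (R.map E.toHomeomorph).carrier,
          (R.map E.toHomeomorph).IsUniformizing ψ (-x') := by
      intro R R' φ' x' hU hc hp
      obtain ⟨ψ', -, hψ'⟩ := hU.exists_conjugate
      refine exists_isUniformizing_of_eq_image_mul ha ?_ ?_ hψ'
      · rw [hmapc, MarkedDomain.conjugate_carrier, conjSet_eq_image, hc, image_image, image_image]
        exact image_congr' fun z ↦ by rw [hEz, hshear]
      · intro i
        rw [hmapp, MarkedDomain.conjugate_pt, hp i, hEz, hshear]
    obtain ⟨ψ₁, hψ₁⟩ := key R₁ R₁' φ₁' x₁' h₁' hc₁ hp₁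
    obtain ⟨ψ₂, hψ₂⟩ := key R₂ R₂' φ₂' x₂' h₂' hc₂ hp₂
    have e₁ := hE R₁ φ₁ x₁ ψ₁ (-x₁') h₁ hψ₁
    have e₂ := hE R₂ φ₂ x₂ ψ₂ (-x₂') h₂ hψ₂
    rw [crossRatio_neg] at e₁ e₂
    exact hcr' (by rw [← e₁, ← e₂, hcr])
  · -- `im β > 0`, `β ≠ i`
    obtain ⟨R₁, R₂, R₁', R₂', φ₁, x₁, φ₂, x₂, φ₁', x₁', φ₂', x₂', h₁, h₂, h₁', h₂', ⟨hc₁, hp₁⟩,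
      ⟨hc₂, hp₂⟩, hcr, hcr'⟩ := BeffaraShearDistortsModulus_holds β hgt hne.1
    have key : ∀ (R R' : ConformalRectangle) (φ' : ConformalEquiv upperHalfPlaneSet R'.carrier)
        (x' : Fin 4 → ℝ), R'.IsUniformizing φ' x' → R'.carrier = moduliShear β '' R.carrier →
        (∀ i, R'.pt i = moduliShear β (R.pt i)) →
        ∃ ψ : ConformalEquiv upperHalfPlaneSet (R.map E.toHomeomorph).carrier,
          (R.map E.toHomeomorph).IsUniformizing ψ x' := by
      intro R R' φ' x' hU hc hp
      refine exists_isUniformizing_of_eq_image_mul ha ?_ ?_ hU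
      · rw [hmapc, hc, image_image]
        exact image_congr' fun z ↦ hEz z
      · intro i
        rw [hmapp, hp i, hEz]
    obtain ⟨ψ₁, hψ₁⟩ := key R₁ R₁' φ₁' x₁' h₁' hc₁ hp₁
    obtain ⟨ψ₂, hψ₂⟩ := key R₂ R₂' φ₂' x₂' h₂' hc₂ hp₂
    have e₁ := hE R₁ φ₁ x₁ ψ₁ x₁' h₁ hψ₁
    have e₂ := hE R₂ φ₂ x₂ ψ₂ x₂' h₂ hψ₂
    exact hcr' (by rw [← e₁, ← e₂, hcr])

end Summit.CriticalPhenomena.CardyFormulaZ2.Theorems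

end
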